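import Summits.CriticalPhenomena.SAWScalingLimit.Theorems.BoundaryClosureNegative_Corridor
import Summits.CriticalPhenomena.SAWScalingLimit.Theorems.BoundaryClosureNegative_Connected
import Summits.CriticalPhenomena.SAWScalingLimit.Theorems.BoundaryClosureNegative_Endgame

/-!
# Negative knowledge on crux `BoundaryClosure` — the corridor refutation of `HexObservableLimit`, part 10: one instance of the hypotheses

For a configuration `wc` (body with root at the junction cell `X`, marked point `1/2`; or body ∪ corridor
with root at the tip cell `T`, marked point `3/4`) on the half-disc, every hypothesis of
`HexObservableLimit` holds (`instance_limit`, stated against the literal hypothesis list of the item, so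
that this support file does not import the route file), hence the normalised averages converge to the
predicted limit `c ∫ ψ e^{(5/8)(L_r - L_r 0)}`. Support for
`SAWDefectDecoherenceHexObservableLimitRefutation.lean` (item stmt-CriticalPhenomena-5420, the conclusion of
crux `BoundaryClosure`, stmt-CriticalPhenomena-8536). Everything proved. [folklore]
-/

noncomputable section

open Set Filter Topology Complex
open Literature.Probability.RandomPlanarGeometry
open UpperHalfPlane (upperHalfPlaneSet)
open Literature.Probability.LatticeModels Literature.Probability.RandomPlanarGeometry.SAW

namespace Summit.CriticalPhenomena.SAWScalingLimit.Theorems.BoundaryClosure.Negative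

/-! ### Small meshes, the predicted density, one instance of the hypotheses -/

/-- Small positive meshes, eventually. [folklore] -/
theorem eventually_small {η : ℝ} (hη : 0 < η) :
    ∀ᶠ δ : ℝ in 𝓝[>] 0, 0 < δ ∧ δ ≤ 1 / 16 ∧ δ ≤ η := by
  have h : Ioo (0:ℝ) (min (1 / 16) η) ∈ 𝓝[>] (0:ℝ) := Ioo_mem_nhdsGT (lt_min (by norm_num) hη)
  filter_upwards [h] with δ hδ
  exact ⟨hδ.1, (hδ.2.le.trans (min_le_left _ _)), hδ.2.le.trans (min_le_right _ _)⟩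

/-- The predicted limit density `exp((5/8)(L_r - L_r 0))` is continuous on the half-disc. [folklore] -/
theorem continuousOn_g {r : ℝ} (hr : 0 < r ∧ r < 1) :
    ContinuousOn (fun z => Complex.exp ((5 / 8 : ℂ) * (Lfun r z - Lfun r 0))) HD :=
  Complex.continuous_exp.comp_continuousOn (continuousOn_const.mul ((continuousOn_Lfun hr).sub
    continuousOn_const))

/-- **One instance of `HexObservableLimit` on the half-disc**: configuration `wc` (body with root at
the junction `X`, marked point `1/2`; or body ∪ corridor with root at the tip `T`, marked point `3/4`)
satisfies every hypothesis, so the normalised averages converge to the predicted limit. [folklore] -/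
theorem instance_limit {c : ℂ}
    (H : ∀ (D : Literature.Probability.RandomPlanarGeometry.DobrushinDomain) (ρ : ℝ)
      (Λ : ℝ → Finset Literature.Probability.LatticeModels.HexVertex) (m : ℝ → ℤ)
      (a b : ℝ → Sym2 Literature.Probability.LatticeModels.HexVertex)
      (Φ : Literature.Probability.RandomPlanarGeometry.ConformalEquiv D.carrier UpperHalfPlane.upperHalfPlaneSet)
      (L : ℂ → ℂ) (Lb : ℂ) (ψ : ℂ → ℂ),
      let F : ℝ → Sym2 Literature.Probability.LatticeModels.HexVertex → ℂ := fun δ z =>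
        Literature.Probability.RandomPlanarGeometry.SAW.hexParafermionicObservable (Λ δ) (a δ)
          Literature.Probability.RandomPlanarGeometry.SAW.hexCriticalFugacity (5 / 8) z
      0 < ρ → D.carrier ∩ Metric.ball (D.pt 1) ρ = {z : ℂ | (D.pt 1).im < z.im} ∩ Metric.ball (D.pt 1) ρ →
      (∀ᶠ δ : ℝ in nhdsWithin 0 (Set.Ioi 0),
        Literature.Probability.RandomPlanarGeometry.SAW.hexDomainSimplyConnected (Λ δ) ∧
        a δ ∈ Literature.Probability.RandomPlanarGeometry.SAW.hexDomainBoundary (Λ δ) ∧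
        b δ ∈ Literature.Probability.RandomPlanarGeometry.SAW.hexDomainBoundary (Λ δ) ∧
        Nonempty (Literature.Probability.RandomPlanarGeometry.SAW.HexMidEdgeSAW (Λ δ) (a δ) (b δ)) ∧
        (Literature.Probability.LatticeModels.hexGraph.induce ((Λ δ : Finset
          Literature.Probability.LatticeModels.HexVertex) : Set
          Literature.Probability.LatticeModels.HexVertex)).Preconnected ∧
        (∀ v ∈ Λ δ, (δ : ℂ) * Literature.Probability.LatticeModels.hexCenter v ∈ D.carrier) ∧
        (∀ v : Literature.Probability.LatticeModels.HexVertex, (δ : ℂ) *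
          Literature.Probability.LatticeModels.hexCenter v ∈ Metric.ball (D.pt 1) ρ → (v ∈ Λ δ ↔ m δ ≤ v.1 1))) →
      (∀ K : Set ℂ, IsCompact K → K ⊆ D.carrier → ∀ᶠ δ : ℝ in nhdsWithin 0 (Set.Ioi 0), ∀ v :
        Literature.Probability.LatticeModels.HexVertex, (δ : ℂ) *
        Literature.Probability.LatticeModels.hexCenter v ∈ K → v ∈ Λ δ) →
      Filter.Tendsto (fun δ : ℝ => (δ : ℂ) * Literature.Probability.RandomPlanarGeometry.SAW.hexMidpoint (a δ))
        (nhdsWithin 0 (Set.Ioi 0)) (nhds (D.pt 0)) →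
      Filter.Tendsto (fun δ : ℝ => (δ : ℂ) * Literature.Probability.RandomPlanarGeometry.SAW.hexMidpoint (b δ))
        (nhdsWithin 0 (Set.Ioi 0)) (nhds (D.pt 1)) →
      Filter.Tendsto (fun x => ‖Φ x‖) (nhdsWithin (D.pt 0) D.carrier) Filter.atTop →
      Φ.HasBoundaryValue (D.pt 1) 0 → ContinuousOn L D.carrier → (∀ z ∈ D.carrier, Complex.exp (L z) = deriv Φ z) →
      Filter.Tendsto L (nhdsWithin (D.pt 1) D.carrier) (nhds Lb) → Continuous ψ → HasCompactSupport ψ →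
      tsupport ψ ⊆ D.carrier →
      Filter.Tendsto (fun δ : ℝ => (δ : ℂ) ^ 2 * (∑ᶠ e ∈
        Literature.Probability.RandomPlanarGeometry.SAW.hexDomainMidEdges (Λ δ), ψ ((δ : ℂ) *
        Literature.Probability.RandomPlanarGeometry.SAW.hexMidpoint e) * F δ e) / F δ (b δ))
        (nhdsWithin 0 (Set.Ioi 0)) (nhds (c * ∫ z, ψ z * Complex.exp ((5 / 8 : ℂ) * (L z - Lb)))))
    {r : ℝ} (hr : 0 < r ∧ r < 1) (wc : Bool) (hroot : ∀ δ : ℝ, 0 < δ → |δ * rootCell δ wc - r| ≤ δ)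
    {ψ : ℂ → ℂ} (hψc : Continuous ψ) (hψK : HasCompactSupport ψ) (hψD : tsupport ψ ⊆ HD) :
    Filter.Tendsto (fun δ : ℝ => (δ : ℂ) ^ 2 * (∑ᶠ e ∈ hexDomainMidEdges (Lam δ wc),
        ψ ((δ : ℂ) * hexMidpoint e) * hexParafermionicObservable (Lam δ wc) (aEdge (rootCell δ wc))
          hexCriticalFugacity (5 / 8) e) /
        hexParafermionicObservable (Lam δ wc) (aEdge (rootCell δ wc)) hexCriticalFugacity (5 / 8) bEdge)
      (nhdsWithin 0 (Set.Ioi 0))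
      (nhds (c * ∫ z, ψ z * Complex.exp ((5 / 8 : ℂ) * (Lfun r z - Lfun r 0)))) := by
  have H' := H (halfDiscDomain r hr) (1 / 2) (fun δ => Lam δ wc) (fun _ => 0) (fun δ => aEdge (rootCell δ wc))
    (fun _ => bEdge) (PhiCE r hr) (Lfun r) (Lfun r 0) ψ
  simp only [pt_zero_halfDiscDomain, pt_one_halfDiscDomain] at H'
  refine H' (by norm_num) HD_inter_ball ?_ ?_ ?_ ?_ (tendsto_norm_PhiCE hr) (tendsto_PhiCE_zero hr)
    (continuousOn_Lfun hr) (fun z hz => exp_Lfun hr hz) (tendsto_Lfun_zero hr) hψc hψK hψD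
  · -- the discrete hypotheses, for `0 < δ ≤ 1/16`
    filter_upwards [eventually_small one_pos] with δ hδ
    obtain ⟨hδ, hδ', -⟩ := hδ
    refine ⟨simplyConnected_Lam hδ hδ' wc, aEdge_mem_boundary hδ hδ' wc, bEdge_mem_boundary hδ hδ' wc,
      nonempty_saw hδ hδ' wc, preconnected_Lam hδ hδ' wc, fun v hv => smul_center_mem_HD hδ hδ' wc hv,
      fun v hv => ?_⟩
    exact mem_Lam_iff_of_ball hδ hδ' wc hv
  · -- exhaustion of compacts
    intro K hK hKD
    obtain ⟨ε, hε, hε1, hthick⟩ := exists_thick_of_isCompact hK hKD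
    filter_upwards [eventually_small (by positivity : 0 < ε / 4)] with δ hδ v hv
    obtain ⟨hδ, hδ', hδε⟩ := hδ
    obtain ⟨hn, hi⟩ := hthick _ hv
    exact mem_Lam_of_thick hδ hδ' wc hδε hn hi
  · exact tendsto_smul_midpoint_aEdge hroot
  · exact tendsto_smul_midpoint_bEdge


end Summit.CriticalPhenomena.SAWScalingLimit.Theorems.BoundaryClosure.Negative
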